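import Literature.AlgebraicGeometry.Motives.AbelianVarietyCohomologyAbelianType
import Literature.AlgebraicGeometry.Motives.HodgeStructureExteriorPowerGeneralWeight
import Literature.AlgebraicGeometry.Motives.HodgeStructureAbelianTypePolarizable
import Literature.AlgebraicGeometry.Motives.HodgeTensorFactsHolds
import HarnessLib

/-!
# `⋀ᵏ H` is a direct summand of `H^{⊗k}` in the category of `ℚ`-Hodge structures (every weight)

Layer A1 of the Hodge foundations lane (`lit-hodgefound`; sequel to
`Motives/HodgeStructureExteriorPowerGeneralWeight` — `HodgeStructure.exteriorPower H k`, the `k`-th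
exterior power of a `ℚ`-Hodge structure of ANY weight `n`, with filtration
`Fᵖ ⋀ᵏ V_ℂ = Σ_{a₁+⋯+a_k ≥ p} F^{a₁} ∧ ⋯ ∧ F^{a_k}` (`totalWedgeFiltration`) — and to
`Motives/AbelianVarietyCohomologyAbelianType`, which proves the direct-summand statement below for
structures with `F⁰ = V_ℂ`, `F² = 0` (the case `H¹(A)` of an abelian variety) and supplies the two
linear maps). Sources, verbatim:

* P. Deligne, *Théorie de Hodge II*, Publ. Math. IHÉS 40 (1971), 1.1.12 (cite-only, acq-00429;
  the statement used is the one reprinted in the held references of `HodgeTensorHodgeNumberProofs`):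
  the filtration of a tensor product, `Fᵖ(⊗ᵢ Vᵢ) = Σ_{Σ aᵢ = p} ⊗ᵢ F^{aᵢ} Vᵢ` — the tree's
  `HodgeStructure.tensorPowerFiltration` (`Motives/HodgeTensor`: `⨆_{p ≤ Σ aᵢ} ⊗ᵢ F^{aᵢ}`).
* W. Greub, *Multilinear Algebra*, 2nd ed. (1978), §4.2 (p. 85): "The *alternator* in `⊗ᵖE` is the
  linear map `π_A = (1/p!) Σ_σ ε_σ σ`", and §5.3: the map `η : ∧ᵖE → ⊗ᵖE` induced by `π_A` and the
  projection `π : ⊗ᵖE → ∧ᵖE` satisfy "`π ∘ η = ι`. This implies that `η` is injective" — the tree's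
  `HodgeStructure.tensorToWedge` (`π`), `HodgeStructure.wedgeToTensor` (`η`),
  `HodgeStructure.tensorToWedge_wedgeToTensor` (`π ∘ η = ι`).
* B. Moonen, *Families of motives and the Mumford–Tate conjecture*, Milan J. Math. 85 (2017), §3:
  the Hodge structures of abelian type form the Tannakian subcategory generated by the `H¹(A)`,
  stable under `⊗`, duals, sums and subquotients; in characteristic `0`, `⋀ᵏ H` is the direct
  summand of `H^{⊗k}` cut out by the antisymmetrisation idempotent `(1/k!) Σ_σ sgn(σ) σ`.
* C. Voisin, *Hodge Theory and Complex Algebraic Geometry I* (2002), §7.1.2 and §7.3.1: a sub-Hodge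
  structure of a polarised Hodge structure is polarised by the restricted form (the tree's
  `HodgeStructure.Polarization.comap`); P. Deligne, Hodge II, 2.1.15 (polarisations of tensor
  constructions; the tree's `HodgeStructure.IsPolarizable.tensorPower`).

## What is here (everything PROVED; the two `def`s are the Hodge-morphism packagings of the tree's
linear maps `tensorToWedge`, `wedgeToTensor`; no named fact)

For EVERY `ℚ`-Hodge structure `H` of weight `n` on `V` and every `k` (no effectivity, no level
hypothesis, no finiteness):

* `HodgeStructure.map_tensorPowerFiltration_tensorToWedge_le_exteriorPower_F` — the complexified
  wedge projection `π_ℂ : (V^{⊗k})_ℂ → (⋀ᵏ V)_ℂ` maps `Fᵖ(H^{⊗k})` into `Fᵖ(⋀ᵏ H)`: a tensor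
  `⊗ᵢ xᵢ`, `xᵢ ∈ F^{aᵢ}`, `Σ aᵢ ≥ p`, goes to the wedge `x₁ ∧ ⋯ ∧ x_k ∈ F^{a₁} ∧ ⋯ ∧ F^{a_k}`;
* `HodgeStructure.map_exteriorPower_F_wedgeToTensor_le` — the complexified normalised
  antisymmetrisation `η_ℂ` maps `Fᵖ(⋀ᵏ H)` into `Fᵖ(H^{⊗k})`: a wedge `w₁ ∧ ⋯ ∧ w_k`, `wᵢ ∈ F^{aᵢ}`,
  `Σ aᵢ ≥ p`, goes to `(1/k!) Σ_σ sgn(σ) ⊗ᵢ w_{σ(i)}` and `⊗ᵢ w_{σ(i)} ∈ ⊗ᵢ F^{a_{σ(i)}}`,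
  `Σᵢ a_{σ(i)} = Σᵢ aᵢ`;
* the Hodge morphisms **`HodgeStructure.Hom.tensorToWedge H k : H^{⊗k} → ⋀ᵏ H`** and
  **`HodgeStructure.Hom.wedgeToTensor H k : ⋀ᵏ H → H^{⊗k}`** (under the standing instance
  `[HodgeTensorFacts]` of `HodgeStructure.tensorPower`, which the tree discharges:
  `hodgeTensorFacts_holds`), with `Hom.tensorToWedge_comp_wedgeToTensor = Hom.id` — **`⋀ᵏ H` is a
  retract (direct summand) of `H^{⊗k}`** — `wedgeToTensor_injective`, `tensorToWedge_surjective`;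
* consequences: **`HodgeStructure.IsPolarizable.exteriorPower`** — the exterior powers of a
  polarisable Hodge structure on a finite-dimensional `V` are polarisable (pull back a polarisation
  of `H^{⊗k}`, the tree's `IsPolarizable.tensorPower`, along the injective morphism `η`,
  `Polarization.comap`) — in particular every `Hᵏ = ⋀ᵏ H¹` of a polarised weight-one structure;
  `HodgeStructure.IsOfAbelianType.exteriorPower_of_tensorPower` (a retract of a structure of
  abelian type is of abelian type, the tree's `IsOfAbelianType.of_retract`).

## References

* P. Deligne, *Théorie de Hodge II*, Publ. Math. IHÉS 40 (1971), 1.1.12, 2.1.15. [DeligneHodgeII1971]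
* W. Greub, *Multilinear Algebra*, 2nd ed., Universitext, Springer (1978), §4.2 (p. 85), §5.3
  (held `book:greub1978-multilinear-algebra`). [Greub1978Multilinear]
* B. Moonen, *Families of motives and the Mumford–Tate conjecture*, Milan J. Math. 85 (2017),
  257–307, §3. [Moonen2017FamiliesMotives]
* C. Voisin, *Hodge Theory and Complex Algebraic Geometry I*, CUP (2002), §7.1.2, §7.3.1.
  [VoisinHodgeI2002]
* D. Huybrechts, *Lectures on K3 Surfaces* (2016), Ch. 3 §1.1 (v) (the exterior power of a Hodge
  structure of weight `n`). [Huybrechts2016K3]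
-/

noncomputable section

open scoped TensorProduct

universe u

namespace Literature.AlgebraicGeometry.Motives

namespace HodgeStructure

variable {V : Type u} [AddCommGroup V] [Module ℚ V] {n : ℤ} {k : ℕ}

/-! ### The two filtration inequalities, every weight -/

/-- **`π_ℂ (Fᵖ(H^{⊗k})) ⊆ Fᵖ(⋀ᵏ H)`** for every `ℚ`-Hodge structure `H` of weight `n` and every `k`:
Deligne's tensor-power filtration `Fᵖ(V^{⊗k}) = Σ_{p ≤ Σ aᵢ} ⊗ᵢ F^{aᵢ}` is mapped by the
complexified wedge projection `⊗ᵢ xᵢ ↦ x₁ ∧ ⋯ ∧ x_k` into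
`Fᵖ ⋀ᵏ V_ℂ = Σ_{Σ aᵢ ≥ p} F^{a₁} ∧ ⋯ ∧ F^{a_k}` (the filtration of `HodgeStructure.exteriorPower`,
read through the canonical base change `θ₀`). [cite: DeligneHodgeII1971, 1.1.12]
[cite: Huybrechts2016K3, Ch. 3 §1.1 (v)] -/
theorem map_tensorPowerFiltration_tensorToWedge_le_exteriorPower_F (H : HodgeStructure V n)
    (k : ℕ) (p : ℤ) :
    (H.tensorPowerFiltration k p).map ((tensorToWedge ℚ V k).baseChange ℂ) ≤
      (H.exteriorPower k).F p := by
  have hθ := isExteriorPowerBaseChange_exteriorPowerBaseChangeEquiv (V := V) (k := k)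
  rw [Submodule.map_le_iff_le_comap]
  refine iSup_le fun a ↦ iSup_le fun ha ↦ ?_
  rintro X ⟨Y, hY⟩
  rw [Submodule.mem_comap, exteriorPower_F, Submodule.mem_comap,
    ← exteriorPowerBaseChangeEquiv_apply, exteriorBaseChange_tensorToWedge_baseChange _ hθ, ← hY]
  clear hY
  induction Y using PiTensorProduct.induction_on with
  | smul_tprod c g =>
    rw [map_smul, map_smul]
    refine Submodule.smul_mem _ c ?_
    rw [PiTensorProduct.mapIncl, PiTensorProduct.map_tprod, tensorToWedge_tprod]
    exact ιMulti_mem_totalWedgeFiltration H.F _ a (fun i ↦ (g i).2) ha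
  | add x y hx hy =>
    rw [map_add, map_add]
    exact Submodule.add_mem _ hx hy

/-- **`η_ℂ (Fᵖ(⋀ᵏ H)) ⊆ Fᵖ(H^{⊗k})`** for every `ℚ`-Hodge structure `H` of weight `n` and every `k`:
a generating wedge `w₁ ∧ ⋯ ∧ w_k` of `Fᵖ ⋀ᵏ V_ℂ` (`wᵢ ∈ F^{aᵢ}`, `Σ aᵢ ≥ p`) is mapped by the
complexified normalised antisymmetrisation to `(1/k!) Σ_σ sgn(σ) ⊗ᵢ w_{σ(i)}`, and
`⊗ᵢ w_{σ(i)} ∈ ⊗ᵢ F^{a_{σ(i)}}` with `Σᵢ a_{σ(i)} = Σᵢ aᵢ ≥ p`. [cite: DeligneHodgeII1971, 1.1.12]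
[cite: Greub1978Multilinear, §4.2 (p. 85) and §5.3] -/
theorem map_exteriorPower_F_wedgeToTensor_le (H : HodgeStructure V n) (k : ℕ) (p : ℤ) :
    ((H.exteriorPower k).F p).map ((wedgeToTensor V k).baseChange ℂ) ≤
      H.tensorPowerFiltration k p := by
  classical
  have hθ := isExteriorPowerBaseChange_exteriorPowerBaseChangeEquiv (V := V) (k := k)
  rintro _ ⟨x, hx, rfl⟩
  apply mem_tensorPowerFiltration_of_piTensorBaseChange_mem
  rw [wedgeToTensor, LinearMap.baseChange_smul, LinearMap.smul_apply, LinearMap.map_smul_of_tower,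
    piTensorBaseChange_toTensorPower_baseChange _ hθ]
  refine Submodule.smul_of_tower_mem _ _ ?_
  have hθx : exteriorPowerBaseChangeEquiv V k x ∈ totalWedgeFiltration H.F k p := hx
  -- it suffices to treat the spanning wedges `w₁ ∧ ⋯ ∧ w_k`, `wᵢ ∈ F^{aᵢ}`, `p ≤ Σ aᵢ`
  rw [totalWedgeFiltration_def] at hθx
  rw [← Submodule.mem_comap]
  refine (Submodule.span_le.2 ?_) hθx
  rintro _ ⟨w, a, hw, ha, rfl⟩
  rw [SetLike.mem_coe, Submodule.mem_comap, exteriorPower.toTensorPower_apply_ιMulti]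
  refine Submodule.sum_mem _ fun σ _ ↦ ?_
  rw [Units.smul_def, ← Int.cast_smul_eq_zsmul ℂ]
  refine Submodule.smul_mem _ _ ?_
  have haσ : p ≤ ∑ i, a (σ i) := by rwa [Equiv.sum_comp σ a]
  refine Submodule.mem_iSup_of_mem (fun i ↦ a (σ i)) (Submodule.mem_iSup_of_mem haσ ?_)
  exact ⟨PiTensorProduct.tprod ℂ fun i ↦ (⟨w (σ i), hw (σ i)⟩ : H.F (a (σ i))), by
    rw [PiTensorProduct.mapIncl, PiTensorProduct.map_tprod]; rfl⟩

/-- The normalised antisymmetrisation `η : ⋀ᵏ V → V^{⊗k}` is injective (`π ∘ η = ι`, Greub §5.3: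
"This implies that `η` is injective"). [cite: Greub1978Multilinear, §5.3] -/
theorem wedgeToTensor_injective (k : ℕ) : Function.Injective (wedgeToTensor V k) :=
  Function.LeftInverse.injective (tensorToWedge_wedgeToTensor k)

/-- The wedge projection `π : V^{⊗k} → ⋀ᵏ V` is surjective (it has the section `η`).
[cite: Greub1978Multilinear, §5.3] -/
theorem tensorToWedge_surjective (k : ℕ) : Function.Surjective (tensorToWedge ℚ V k) :=
  Function.RightInverse.surjective (tensorToWedge_wedgeToTensor k)

/-! ### The Hodge morphisms `π : H^{⊗k} → ⋀ᵏ H`, `η : ⋀ᵏ H → H^{⊗k}`; `⋀ᵏ H` is a retract of `H^{⊗k}` -/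

section Hom

variable [HodgeTensorFacts.{u, u}]

/-- **The wedge projection is a morphism of Hodge structures `π : H^{⊗k} → ⋀ᵏ H`** (both of weight
`kn`; every weight `n`, every `k`). [cite: DeligneHodgeII1971, 1.1.12] [cite: Moonen2017FamiliesMotives, §3] -/
def Hom.tensorToWedge (H : HodgeStructure V n) (k : ℕ) : Hom (H.tensorPower k) (H.exteriorPower k) where
  toLinearMap := Motives.HodgeStructure.tensorToWedge ℚ V k
  map_F_le p := by
    rw [tensorPower_F]
    exact map_tensorPowerFiltration_tensorToWedge_le_exteriorPower_F H k p

/-- The linear map of `Hom.tensorToWedge` is the wedge projection. [cite: Greub1978Multilinear, §5.3] -/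
@[simp]
theorem Hom.tensorToWedge_toLinearMap (H : HodgeStructure V n) (k : ℕ) :
    (Hom.tensorToWedge H k).toLinearMap = Motives.HodgeStructure.tensorToWedge ℚ V k := rfl

/-- **The normalised antisymmetrisation is a morphism of Hodge structures `η : ⋀ᵏ H → H^{⊗k}`**
(every weight `n`, every `k`). [cite: DeligneHodgeII1971, 1.1.12] [cite: Moonen2017FamiliesMotives, §3] -/
def Hom.wedgeToTensor (H : HodgeStructure V n) (k : ℕ) : Hom (H.exteriorPower k) (H.tensorPower k) where
  toLinearMap := Motives.HodgeStructure.wedgeToTensor V k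
  map_F_le p := by
    rw [tensorPower_F]
    exact map_exteriorPower_F_wedgeToTensor_le H k p

/-- The linear map of `Hom.wedgeToTensor` is the normalised antisymmetrisation.
[cite: Greub1978Multilinear, §5.3] -/
@[simp]
theorem Hom.wedgeToTensor_toLinearMap (H : HodgeStructure V n) (k : ℕ) :
    (Hom.wedgeToTensor H k).toLinearMap = Motives.HodgeStructure.wedgeToTensor V k := rfl

/-- **`⋀ᵏ H` is a retract (direct summand) of `H^{⊗k}` in the category of `ℚ`-Hodge structures**:
`π ∘ η = id_{⋀ᵏ H}` (Greub §5.3 "`π ∘ η = ι`"; Moonen §3: `⋀ᵏ H` is the summand of `H^{⊗k}` cut out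
by the antisymmetrisation idempotent). [cite: Greub1978Multilinear, §5.3] [cite: Moonen2017FamiliesMotives, §3] -/
theorem Hom.tensorToWedge_comp_wedgeToTensor (H : HodgeStructure V n) (k : ℕ) :
    (Hom.tensorToWedge H k).comp (Hom.wedgeToTensor H k) = Hom.id (H.exteriorPower k) :=
  Hom.ext (LinearMap.ext fun x ↦ tensorToWedge_wedgeToTensor k x)

/-- Pointwise form of the retraction: `π (η x) = x`. [cite: Greub1978Multilinear, §5.3] -/
theorem Hom.tensorToWedge_wedgeToTensor_apply (H : HodgeStructure V n) (k : ℕ) (x : ⋀[ℚ]^k V) :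
    (Hom.tensorToWedge H k).toLinearMap ((Hom.wedgeToTensor H k).toLinearMap x) = x :=
  tensorToWedge_wedgeToTensor k x

/-- If `H^{⊗k}` is of abelian type then so is its direct summand `⋀ᵏ H` (stability of André's
`ℳ(𝒜b)` under direct factors; the tree's `IsOfAbelianType.of_retract`).
[cite: Moonen2017FamiliesMotives, §3] -/
theorem IsOfAbelianType.exteriorPower_of_tensorPower {H : HodgeStructure V n} {k : ℕ}
    (h : (H.tensorPower k).IsOfAbelianType) : (H.exteriorPower k).IsOfAbelianType :=
  h.of_retract (Hom.wedgeToTensor H k) (Hom.tensorToWedge H k)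
    (Hom.tensorToWedge_wedgeToTensor_apply H k)

end Hom

/-! ### Exterior powers of polarisable Hodge structures are polarisable -/

/-- **`⋀ᵏ H` is polarisable when `H` is** (finite-dimensional `V`; every weight, every `k`): pull
back a polarisation of `H^{⊗k}` (Deligne, Hodge II, 2.1.15; the tree's `IsPolarizable.tensorPower`)
along the injective morphism of Hodge structures `η : ⋀ᵏ H → H^{⊗k}` (Voisin I, §7.1.2/§7.3.1: the
restriction of a polarisation to a sub-Hodge structure polarises it; the tree's
`Polarization.comap`). In particular every `Hᵏ = ⋀ᵏ H¹` of a polarised weight-one structure is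
polarised. The standing tensor facts are the tree's theorem `hodgeTensorFacts_holds`.
[cite: DeligneHodgeII1971, 2.1.15] [cite: VoisinHodgeI2002, §7.1.2 and §7.3.1] -/
theorem IsPolarizable.exteriorPower [Module.Finite ℚ V] {H : HodgeStructure V n}
    (hH : H.IsPolarizable) (k : ℕ) : (H.exteriorPower k).IsPolarizable := by
  haveI : HodgeTensorFacts.{u, u} := hodgeTensorFacts_holds
  obtain ⟨Q⟩ := hH.tensorPower k
  exact ⟨Q.comap (Hom.wedgeToTensor H k) (wedgeToTensor_injective k)⟩

end HodgeStructure

end Literature.AlgebraicGeometry.Motives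

end
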